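import Summits.MatrixMultiplication.MatrixMultiplication.Theses.SnSubsetDichotomy
import Summits.MatrixMultiplication.MatrixMultiplication.Theorems.SnSubsetDichotomyVershikKerovBound

/-!
# `GlobalBranch` (crux `stmt-MatrixMultiplication-8303`, route `SnSubsetDichotomy`):
# resistance and calibration (negative-side support, cdisprove seat)

The crux says: `∃ ε > 0, ∃ c > 0, ∃ n₀, ∀ n ≥ n₀`, every triple `S, T, U ⊆ S_n` with the triple
product property all of whose three sets are `(1/2+ε)`-bump-free up to level `√n`
(`|X ∩ U_{I→L}|·n^(t) ≤ n^{(1/2+ε)t}|X|` for `1 ≤ t ≤ √n`, `I, L` injective) has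
`|S||T||U| ≤ (n!)^{3/2} e^{-c√n}`.

Proved here (all `sorry`-free, no named facts):

* `not_noThresholdSubsetTriple_of_not_globalBranch`, `not_globalBranch_and_not_summit` —
  **RESISTANCE**: a refutation of the crux refutes the route's negative side `¬X` (i.e. yields
  threshold TPP subset triples) and hence, through the route's deciding theorem `closes` and the
  proved Vershik–Kerov bound, proves `ω(ℂ) = 2`.  So NO CHEAP KILL of the crux exists: every
  unconditional `¬GlobalBranch` is a proof of the summit.
* `globalBranch_iff`, `globalBranchAt_iff_of_half_le`, `globalBranchAt_anti`,
  `globalBranch_iff_small_eps` — **CALIBRATION**: at exponent `ε ≥ 1/2` the bump hypothesis is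
  void (`bumpFree_of_one_le`) and the crux at `(ε, c, n₀)` is literally the no-threshold statement
  at `(c, n₀)`; the crux is antitone in `ε`; only `0 < ε < 1/2` carries content.
* `descFactorial_le_of_bumpFree` — bump-free sets are automatically large
  (`n^(t) ≤ n^{κt}|X|` at every admissible level), so the crux never sees small sets.
-/

noncomputable section

set_option linter.dupNamespace false

namespace Summit.MatrixMultiplication.MatrixMultiplication.Theorems.GlobalBranch.Negative

open Summit.MatrixMultiplication.MatrixMultiplication.Theses.SnSubsetDichotomy
open Literature.Combinatorics.Additive

/-! ## Definitions: bump-freeness and the crux at fixed parameters -/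

/-- `κ`-bump-freeness of a set `X ⊆ S_n` up to level `√n` (the crux uses `κ = 1/2 + ε`):
`|X ∩ U_{I→L}|·n^(t) ≤ n^{κ t}·|X|` for `1 ≤ t ≤ √n` and injective `I, L : Fin t → Fin n`, where
`U_{I→L} = {σ : σ ∘ I = L}` is the `t`-umvirate; verbatim the inner hypothesis of the crux.
[folklore] -/
def BumpFree {n : ℕ} (κ : ℝ) (X : Finset (Equiv.Perm (Fin n))) : Prop :=
  ∀ t : ℕ, 1 ≤ t → (t : ℝ) ≤ Real.sqrt (n : ℝ) → ∀ I L : Fin t → Fin n, Function.Injective I →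
    Function.Injective L →
      ((X.filter (fun σ => ∀ k, σ (I k) = L k)).card : ℝ) * (n.descFactorial t : ℝ) ≤
        (n : ℝ) ^ (κ * t) * (X.card : ℝ)

/-- The crux at fixed parameters `(ε, c, n₀)`. [folklore] -/
def GlobalBranchAt (ε c : ℝ) (n₀ : ℕ) : Prop :=
  ∀ n ≥ n₀, ∀ S T U : Finset (Equiv.Perm (Fin n)), TripleProductProperty S T U →
    (∀ X : Finset (Equiv.Perm (Fin n)), (X = S ∨ X = T ∨ X = U) → BumpFree (1 / 2 + ε) X) →
      ((S.card * T.card * U.card : ℕ) : ℝ) ≤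
        (n.factorial : ℝ) ^ ((3 : ℝ) / 2) * Real.exp (-(c * Real.sqrt (n : ℝ)))

/-- The no-threshold statement at fixed parameters `(c, n₀)`. [folklore] -/
def NoThresholdAt (c : ℝ) (n₀ : ℕ) : Prop :=
  ∀ n ≥ n₀, ∀ S T U : Finset (Equiv.Perm (Fin n)), TripleProductProperty S T U →
    ((S.card * T.card * U.card : ℕ) : ℝ) ≤
      (n.factorial : ℝ) ^ ((3 : ℝ) / 2) * Real.exp (-(c * Real.sqrt (n : ℝ)))

/-- The crux is literally `∃ ε > 0, ∃ c > 0, ∃ n₀, GlobalBranchAt ε c n₀`. [folklore] -/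
theorem globalBranch_iff :
    GlobalBranch ↔ ∃ ε : ℝ, 0 < ε ∧ ∃ c : ℝ, 0 < c ∧ ∃ n₀ : ℕ, GlobalBranchAt ε c n₀ :=
  Iff.rfl

/-- The negative side is literally `∃ c > 0, ∃ n₀, NoThresholdAt c n₀`. [folklore] -/
theorem noThresholdSubsetTriple_iff :
    NoThresholdSubsetTriple ↔ ∃ c : ℝ, 0 < c ∧ ∃ n₀ : ℕ, NoThresholdAt c n₀ :=
  Iff.rfl

/-! ## Resistance: refuting the crux proves the summit -/

/-- `NoThresholdAt c n₀ → GlobalBranchAt ε c n₀` for every `ε`: the crux is the no-threshold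
statement restricted to bump-free triples. [folklore] -/
theorem globalBranchAt_of_noThresholdAt {ε c : ℝ} {n₀ : ℕ} (h : NoThresholdAt c n₀) :
    GlobalBranchAt ε c n₀ :=
  fun n hn S T U hTPP _ => h n hn S T U hTPP

/-- **Resistance.** A refutation of the crux refutes the route's negative side
`NoThresholdSubsetTriple` (forget the bump hypothesis, `ε := 1`); by the route's
`NoThresholdIffNotThreshold` this is the TARGET `ThresholdSubsetTriples`. [folklore] -/
theorem not_noThresholdSubsetTriple_of_not_globalBranch (h : ¬ GlobalBranch) :
    ¬ NoThresholdSubsetTriple := by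
  rintro ⟨c, hc, n₀, hN⟩
  exact h ⟨1, one_pos, c, hc, n₀, globalBranchAt_of_noThresholdAt hN⟩

/-- **Resistance, summit form.** The crux cannot fail while the summit is false: a refutation of
the crux gives threshold TPP subset triples, and the route's deciding theorem `closes` with the
PROVED Vershik–Kerov bound (`vershikKerovBound_proof`) turns them into `ω(ℂ) = 2`.  So every
unconditional `¬GlobalBranch` is a proof of the summit — no cheap kill exists. [folklore] -/
theorem not_globalBranch_and_not_summit : ¬ (¬ GlobalBranch ∧ ¬ MatrixMultiplication) := by
  rintro ⟨hG, hM⟩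
  refine hM (closes ?_ Theorems.vershikKerovBound_proof)
  intro c hc n₀
  by_contra hcon
  refine hG ⟨1, one_pos, c, hc, n₀, fun n hn S T U hTPP _ => ?_⟩
  by_contra hlt
  exact hcon ⟨n, hn, S, T, U, hTPP, lt_of_not_ge hlt⟩

/-- Contrapositive bookkeeping: the crux fails iff at every scale `(ε, c, n₀)` there is a
bump-free TPP triple above the threshold. [folklore] -/
theorem not_globalBranch_iff :
    ¬ GlobalBranch ↔ ∀ ε : ℝ, 0 < ε → ∀ c : ℝ, 0 < c → ∀ n₀ : ℕ, ∃ n ≥ n₀,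
      ∃ S T U : Finset (Equiv.Perm (Fin n)), TripleProductProperty S T U ∧
        (∀ X : Finset (Equiv.Perm (Fin n)), (X = S ∨ X = T ∨ X = U) → BumpFree (1 / 2 + ε) X) ∧
        (n.factorial : ℝ) ^ ((3 : ℝ) / 2) * Real.exp (-(c * Real.sqrt (n : ℝ))) <
          ((S.card * T.card * U.card : ℕ) : ℝ) := by
  rw [globalBranch_iff]
  simp only [GlobalBranchAt, not_exists, not_and, not_forall, not_le, exists_prop]

/-! ## Calibration in `ε` -/

/-- An admissible level `1 ≤ t ≤ √n` forces `0 < n`. [folklore] -/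
theorem pos_of_level {n t : ℕ} (ht : 1 ≤ t) (hts : (t : ℝ) ≤ Real.sqrt (n : ℝ)) : 0 < n := by
  rcases Nat.eq_zero_or_pos n with rfl | hn
  · exfalso
    have h1 : (1 : ℝ) ≤ Real.sqrt ((0 : ℕ) : ℝ) := le_trans (by exact_mod_cast ht) hts
    rw [Nat.cast_zero, Real.sqrt_zero] at h1
    exact absurd h1 (by norm_num)
  · exact hn

/-- Bump-freeness is monotone in the exponent. [folklore] -/
theorem bumpFree_mono {n : ℕ} {κ κ' : ℝ} (hκ : κ ≤ κ') {X : Finset (Equiv.Perm (Fin n))}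
    (h : BumpFree κ X) : BumpFree κ' X := by
  intro t ht hts I L hI hL
  refine (h t ht hts I L hI hL).trans (mul_le_mul_of_nonneg_right ?_ (Nat.cast_nonneg _))
  have hn : 0 < n := pos_of_level ht hts
  exact Real.rpow_le_rpow_of_exponent_le (by exact_mod_cast hn)
    (mul_le_mul_of_nonneg_right hκ (Nat.cast_nonneg _))

/-- For exponent `κ ≥ 1` (i.e. `ε ≥ 1/2`) EVERY set is bump-free: `|X ∩ U|·n^(t) ≤ |X|·n^t`.
[folklore] -/
theorem bumpFree_of_one_le {n : ℕ} {κ : ℝ} (hκ : 1 ≤ κ) (X : Finset (Equiv.Perm (Fin n))) :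
    BumpFree κ X := by
  intro t ht hts I L _ _
  have hn : 0 < n := pos_of_level ht hts
  have h1 : ((X.filter (fun σ => ∀ k, σ (I k) = L k)).card : ℝ) ≤ X.card := by
    exact_mod_cast Finset.card_filter_le _ _
  have h2 : (n.descFactorial t : ℝ) ≤ (n : ℝ) ^ (κ * t) := by
    calc (n.descFactorial t : ℝ) ≤ ((n ^ t : ℕ) : ℝ) := by
            exact_mod_cast Nat.descFactorial_le_pow n t
      _ = (n : ℝ) ^ ((t : ℕ) : ℝ) := by rw [Nat.cast_pow, Real.rpow_natCast]
      _ ≤ (n : ℝ) ^ (κ * t) := by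
            refine Real.rpow_le_rpow_of_exponent_le (by exact_mod_cast hn) ?_
            calc ((t : ℕ) : ℝ) = 1 * t := (one_mul _).symm
              _ ≤ κ * t := mul_le_mul_of_nonneg_right hκ (Nat.cast_nonneg _)
  calc ((X.filter (fun σ => ∀ k, σ (I k) = L k)).card : ℝ) * (n.descFactorial t : ℝ)
      ≤ (X.card : ℝ) * (n : ℝ) ^ (κ * t) :=
        mul_le_mul h1 h2 (Nat.cast_nonneg _) (Nat.cast_nonneg _)
    _ = (n : ℝ) ^ (κ * t) * (X.card : ℝ) := mul_comm _ _

/-- For `ε ≥ 1/2` the crux at `(ε, c, n₀)` IS the no-threshold statement at `(c, n₀)`: the bump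
hypothesis is void there. [folklore] -/
theorem globalBranchAt_iff_of_half_le {ε c : ℝ} {n₀ : ℕ} (hε : 1 / 2 ≤ ε) :
    GlobalBranchAt ε c n₀ ↔ NoThresholdAt c n₀ := by
  refine ⟨fun h n hn S T U hTPP => h n hn S T U hTPP fun X _ => ?_, globalBranchAt_of_noThresholdAt⟩
  exact bumpFree_of_one_le (by linarith) X

/-- The crux is antitone in `ε`: larger `ε` admits more triples. [folklore] -/
theorem globalBranchAt_anti {ε ε' c : ℝ} {n₀ : ℕ} (hε : ε ≤ ε') (h : GlobalBranchAt ε' c n₀) :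
    GlobalBranchAt ε c n₀ :=
  fun n hn S T U hTPP hB => h n hn S T U hTPP fun X hX => bumpFree_mono (by linarith) (hB X hX)

/-- Only `0 < ε < 1/2` carries content: at `ε ≥ 1/2` the crux is `¬X` itself, and a witness `ε`
can always be shrunk. [folklore] -/
theorem globalBranch_iff_small_eps :
    GlobalBranch ↔ ∃ ε : ℝ, 0 < ε ∧ ε < 1 / 2 ∧ ∃ c : ℝ, 0 < c ∧ ∃ n₀ : ℕ, GlobalBranchAt ε c n₀ := by
  rw [globalBranch_iff]
  constructor
  · rintro ⟨ε, hε, c, hc, n₀, h⟩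
    refine ⟨min ε (1 / 4), lt_min hε (by norm_num), ?_, c, hc, n₀, ?_⟩
    · exact (min_le_right _ _).trans_lt (by norm_num)
    · exact globalBranchAt_anti (min_le_left _ _) h
  · rintro ⟨ε, hε, -, c, hc, n₀, h⟩
    exact ⟨ε, hε, c, hc, n₀, h⟩

/-! ## The hypothesis class: bump-free sets are large -/

/-- A non-empty `κ`-bump-free set satisfies `n^(t) ≤ n^{κ t}·|X|` at every admissible level `t`
(the umvirate through any element of `X` is non-empty). In the crux (`κ = 1/2 + ε`, `t = ⌊√n⌋`)
this reads `|X| ≥ n^{(1/2-ε)√n (1+o(1))}`: the statement never sees small sets. [folklore] -/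
theorem descFactorial_le_of_bumpFree {n : ℕ} {κ : ℝ} {X : Finset (Equiv.Perm (Fin n))}
    (h : BumpFree κ X) (hX : X.Nonempty) {t : ℕ} (ht : 1 ≤ t) (hts : (t : ℝ) ≤ Real.sqrt (n : ℝ))
    (htn : t ≤ n) : (n.descFactorial t : ℝ) ≤ (n : ℝ) ^ (κ * t) * (X.card : ℝ) := by
  obtain ⟨σ₀, hσ₀⟩ := hX
  let I : Fin t → Fin n := fun k => ⟨k, lt_of_lt_of_le k.isLt htn⟩
  have hI : Function.Injective I := fun a b hab => by
    apply Fin.ext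
    have := congrArg Fin.val hab
    simpa [I] using this
  let L : Fin t → Fin n := fun k => σ₀ (I k)
  have hL : Function.Injective L := σ₀.injective.comp hI
  have key := h t ht hts I L hI hL
  have hmem : σ₀ ∈ X.filter (fun σ => ∀ k, σ (I k) = L k) := by
    simp only [Finset.mem_filter]
    exact ⟨hσ₀, fun k => rfl⟩
  have h1 : (1 : ℝ) ≤ ((X.filter (fun σ => ∀ k, σ (I k) = L k)).card : ℝ) := by
    exact_mod_cast Finset.card_pos.2 ⟨σ₀, hmem⟩
  calc (n.descFactorial t : ℝ) = 1 * (n.descFactorial t : ℝ) := (one_mul _).symm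
    _ ≤ ((X.filter (fun σ => ∀ k, σ (I k) = L k)).card : ℝ) * (n.descFactorial t : ℝ) :=
        mul_le_mul_of_nonneg_right h1 (Nat.cast_nonneg _)
    _ ≤ (n : ℝ) ^ (κ * t) * (X.card : ℝ) := key

end Summit.MatrixMultiplication.MatrixMultiplication.Theorems.GlobalBranch.Negative
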